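import Mathlib.Analysis.InnerProductSpace.Calculus
import Mathlib.Analysis.Calculus.Deriv.Mul
import Mathlib.Analysis.Calculus.ParametricIntegral
import Mathlib.Analysis.Calculus.FDeriv.Symmetric
import Mathlib.Analysis.Calculus.MeanValue
import Mathlib.MeasureTheory.Integral.Average
import Mathlib.MeasureTheory.Integral.IntervalIntegral.FundThmCalculus
import Literature.Analysis.FluidPDE.PineauVicolRSS
import Literature.Analysis.FluidPDE.CurlFreeLiouville
import Literature.Analysis.FluidPDE.AxisymmetricVorticityTransport
import Literature.Analysis.FluidPDE.SwirlTransportProofs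
import HarnessLib

/-!
# Pineau–Vicol 2026, Theorems 1.4 / 1.7 — first steps of the printed proofs (proofs file)

Analysis/FluidPDE proofs file (no definitions, no named facts) accompanying the named facts
`pineauVicol2026_rss_liouville` (Thm. 1.4) and `pineauVicol2026_rdss_liouville` (Thm. 1.7) of
`PineauVicolRSS.lean` (B. Pineau, V. Vicol, *On rotated backwards self-similar solutions of the
incompressible 3D Navier–Stokes equations*, arXiv:2607.09619v2, 2026; held as
`paper:arxiv-2607.09619`, printed page numbers below).

**Status of the discharge.** `pineauVicol2026_rdss_liouville_holds` is NOT in the tree. The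
printed proof of Theorem 1.7 (§7, pp. 23–27, small `|α|`; §8, pp. 27–29, large `|α|`, on top of
§§2–6) rests on analytic inputs that neither Mathlib nor `Literature` provides at present:
the principal Dirichlet eigenpair theory for the non-symmetric operator
`L* = −Δ − (U + y/2)·∇ − 3/2` on balls `B_R` (Krein–Rutman / Evans §6.5 Thm. 3, boundary
regularity, barriers, `C²_loc` compactness: Prop. 5.1 via Lemmas 5.3–5.6, pp. 12–17), the
quantitative Serrin interior-regularity estimate for bounded Navier–Stokes solutions at every
derivative order (Lemma 9.1, p. 30, used in Lemmas 2.1 / 7.1 / 8.1), the Calderón–Zygmund and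
Gagliardo–Nirenberg–Sobolev enstrophy estimate (Prop. 3.1 (3.4), p. 11; (7.12), p. 27), and the
weighted `L²_μ` machinery of §6 (Lemmas 6.1–6.4, Prop. 6.5) behind Lemma 8.2 / Prop. 8.3. This
file lands, in the order of the printed argument, the steps that are elementary, so that a later
discharge can start from them:

* **Step 1 = Remark 1.2 and Lemma 7.1, first assertion** (p. 24: "Since `R(αs) ∈ SO(3)`, using
  (1.13a) we obtain that `|U(y,s)| = √(−t)|u(x,t)|` for all `(y,s) ∈ ℝ³ × [0,S]`. The Type I
  bound (1.10) then gives `|U(y,s)| ≤ C_{U,0}(1+|y|)^{−1}` for all `(y,s)`, thereby proving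
  (1.9)"; Remark 1.2, pp. 3–4: within the ansatz "(1.9) is equivalent … to the borderline Type I
  blowup rate (1.10) … The constants in (1.9) and (1.10) are the same"):
  `norm_pvAnsatz` (the size identity), `norm_profile_le_of_typeI_slice` / `…_of_typeI`
  ((1.10) ⇒ (1.9) for `s ≥ 0`), `norm_profile_le_of_typeI_periodic` ((1.10) + the period
  `S = 2 log c`, `c > 1`, of (1.13b) ⇒ (1.9) for every `s`: Lemma 7.1's first assertion under
  the hypotheses of `pineauVicol2026_rdss_liouville`), `typeI_of_norm_profile_le` ((1.9) for
  `s ≥ 0` ⇒ (1.10)) and `typeI_iff_norm_profile_le_rss` (Remark 1.2 verbatim for the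
  time-independent profiles of Theorem 1.4).
* **The profile system's incompressibility (1.14b)**: `profile_slice_eq` inverts the ansatz on a
  time slice, `U(·,s) = √(−t) R(−αs) ∘ u(·,t) ∘ (√(−t) R(αs))`, and `isDivFree_profile_slice`
  derives `∇·U(·,s) = 0` from `∇·u(·,t) = 0` (1.1b) (the trace is conjugation invariant).
* **The endgame of §7.5** (p. 27, last paragraph: "Hence `Ω ≡ 0` on `ℝ³ × [0,S]`. Since
  `∇·U(·,s) = 0`, `∇×U(·,s) = Ω(·,s) = 0`, and `U(·,s) ∈ L⁴(ℝ³)` for each `s`, we obtain that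
  `U ≡ 0`"; likewise the end of the proof of Prop. 3.1, p. 11, and of §8, p. 29):
  `eq_zero_of_curl_eq_zero_of_isDivFree_of_norm_le` (a `C²` irrotational incompressible field
  with the decay (1.9) vanishes — the tree's `eq_of_curl_eq_zero_of_isDivFree_of_bounded` plus
  decay), `profile_slice_eq_zero_of_curl_eq_zero` and `rdss_profile_eq_zero_of_curl_eq_zero`:
  under the hypotheses of `pineauVicol2026_rdss_liouville`, the printed conclusion `U ≡ 0` on
  `ℝ³ × [0, 2 log c]` follows from the vanishing of the profile vorticity `curl U(·,s)`,
  `s ∈ [0, 2 log c]` — which is exactly what the analytic core of the paper ((7.10)–(7.12))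
  establishes and what remains to be formalized.

* **Lemma 4.1** (p. 12): with the infinitesimal rotation `J = rotGen` (so that
  `y₁U₂ − y₂U₁ = ⟪J y, U⟫` and `∂_θ = (J y)·∇`), the error term (4.4)
  `E = ½⟪Jy, U⟫ + ⟪U + ½y, DU(Jy)⟫` is the angular derivative `½ ∂_θ(|U|² + U·y)` (4.6)
  (`errorTerm_eq_half_dtheta`, the product rule) and obeys `|E| ≤ C₀ + C₁ + 2C₀C₁` (4.5) under
  (1.9) and (2.1) (`abs_errorTerm_le`).
* **Lemma 7.2, (7.5)** (pp. 24–25): the fluctuation `Ũ = U − ⟨U⟩_s` from the time mean over a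
  period `[0,S]` obeys `|Ũ(y,s)| ≤ C_{U,s} S/(1+|y|)` when `|∂_sU(y,s)| ≤ C_{U,s}/(1+|y|)` ((7.1))
  (`norm_sub_setAverage_le`, `norm_fluctuation_le`; the mean value inequality and
  `‖∫‖ ≤ ∫‖·‖`), and `|∇Ũ(y,s)| ≤ C_{U,s} S/(1+|y|²)` when `|∇∂_sU| ≤ C_{U,s}/(1+|y|²)`
  (`norm_fderiv_fluctuation_le`, through `∇⟨U⟩_s = ⟨∇U⟩_s` — dominated differentiation under
  the period integral, `hasFDerivAt_setIntegral_Icc` / `hasFDerivAt_setAverage_Icc` — and the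
  mixed-partials identity `∂_s∇U = ∇∂_sU`, `hasDerivAt_fderiv_slice`).

* **The `∂_s`-term dies over a period** (derivation of (7.10), p. 26: "The periodicity in `s` of
  the profile `U` is now used to make the last term in the above identity disappear, upon
  integration in `s` … Here we have crucially used that `w̄` is independent of `s`"):
  `intervalIntegral_deriv_eq_zero_of_periodic`, `intervalIntegral_inner_add_half_smul_deriv_eq_zero`
  (`∫₀^S ⟪U + ½y, ∂_sU⟫ ds = ∫₀^S ∂_s(½|U|² + ½y·U) ds = 0` for an `S`-periodic slice) and
  `integral_weight_mul_intervalIntegral_inner_deriv_eq_zero` (hence `∫ w̄ ∫₀^S ⟪U + ½y, ∂_sU⟫ = 0`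
  for any time-independent weight).

Declarations are grouped in the sub-namespace `Literature.Analysis.FluidPDE.PineauVicol2026`
(it names the paper). Nothing here changes or restates the two named facts.

## References

* B. Pineau, V. Vicol, arXiv:2607.09619 (2026): §1.2 Remark 1.2 (pp. 3–4), (1.9)–(1.10),
  §1.4 (1.13a)–(1.14b) (p. 7), proof of Prop. 3.1, last paragraph (p. 11), §7.1 Lemma 7.1 and
  its proof (pp. 23–24), §4 Lemma 4.1 (4.4)–(4.6) (pp. 11–12), §7.2 Lemma 7.2 (7.4)–(7.5)
  (pp. 24–25), §7.4 derivation of (7.10) (p. 26), §7.5 (p. 27), §8 last paragraph (p. 29).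
  [PineauVicol2026]
* G. Koch, N. Nadirashvili, G. Seregin, V. Šverák, Acta Math. 203 (2009), Lemma 3.1 (the
  curl/div Liouville step, as proved in `CurlFreeLiouville.lean`). [KochNadirashviliSereginSverak2009]
-/

noncomputable section

open Set InnerProductSpace MeasureTheory Filter Metric
open scoped RealInnerProductSpace Topology

namespace Literature.Analysis.FluidPDE

namespace PineauVicol2026

variable {C₀ α : ℝ} {u : ℝ → EuclideanSpace ℝ (Fin 3) → EuclideanSpace ℝ (Fin 3)}
  {U : EuclideanSpace ℝ (Fin 3) → ℝ → EuclideanSpace ℝ (Fin 3)}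

/-! ### Step 1: the Type I bound (1.10) versus the profile bound (1.9) -/

/-- **The size of the ansatz field** (proof of Lemma 7.1, p. 24: "Since `R(αs) ∈ SO(3)`, using
(1.13a) we obtain that `|U(y,s)| = √(−t) |u(x,t)|`"): for the field (1.13a),
`|u(x,t)| = (−t)^{−1/2} |U(y,s)|` with `y = R(−αs) x/√(−t)`, `s = −log(−t)` — rotations about
the axis are isometries (`norm_rotZ`). [cite: PineauVicol2026, proof of Lemma 7.1 (p. 24)] -/
theorem norm_pvAnsatz (α : ℝ) (U : EuclideanSpace ℝ (Fin 3) → ℝ → EuclideanSpace ℝ (Fin 3))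
    (t : ℝ) (x : EuclideanSpace ℝ (Fin 3)) :
    ‖pvAnsatz α U t x‖ = (Real.sqrt (-t))⁻¹ *
      ‖U (rotZ (-(α * -Real.log (-t))) ((Real.sqrt (-t))⁻¹ • x)) (-Real.log (-t))‖ := by
  rw [pvAnsatz, norm_smul, norm_rotZ, norm_inv, Real.norm_of_nonneg (Real.sqrt_nonneg _)]

/-- **Step 1, (1.10) ⇒ (1.9), one time slice** (Remark 1.2 / proof of Lemma 7.1, p. 24): if `u`
obeys the Type I bound `|u(x,t)| ≤ C₀/(|x| + √(−t))` on `ℝ³ × [−1,0)` (1.10) and is given by the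
rotated (discretely) self-similar ansatz (1.13a) with angular speed `α` and profile `U`, then for
every `t ∈ [−1,0)` the profile slice at `s = −log(−t)` obeys `|U(y,s)| ≤ C₀/(1+|y|)` for all `y`
(evaluate (1.10) at `x = √(−t) R(αs) y` and use `|u(x,t)| = (−t)^{−1/2}|U(y,s)|`).
[cite: PineauVicol2026, Remark 1.2 (p. 3) and proof of Lemma 7.1 (p. 24)] -/
theorem norm_profile_le_of_typeI_slice
    (hI : ∀ t ∈ Ico (-1 : ℝ) 0, ∀ x, ‖u t x‖ ≤ C₀ / (‖x‖ + Real.sqrt (-t)))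
    (hA : ∀ t ∈ Ico (-1 : ℝ) 0, ∀ x, u t x = pvAnsatz α U t x)
    {t : ℝ} (ht : t ∈ Ico (-1 : ℝ) 0) (y : EuclideanSpace ℝ (Fin 3)) :
    ‖U y (-Real.log (-t))‖ ≤ C₀ / (1 + ‖y‖) := by
  have hr : 0 < Real.sqrt (-t) := Real.sqrt_pos.2 (by linarith [ht.2])
  have key := hI t ht (Real.sqrt (-t) • rotZ (α * -Real.log (-t)) y)
  rw [hA t ht, norm_pvAnsatz, inv_smul_smul₀ hr.ne', ← rotZ_add, neg_add_cancel, rotZ_zero,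
    norm_smul, norm_rotZ, Real.norm_of_nonneg hr.le] at key
  -- `key : (√(-t))⁻¹ * ‖U y s‖ ≤ C₀ / (√(-t) * ‖y‖ + √(-t))`
  calc ‖U y (-Real.log (-t))‖
      = Real.sqrt (-t) * ((Real.sqrt (-t))⁻¹ * ‖U y (-Real.log (-t))‖) := by
        rw [← mul_assoc, mul_inv_cancel₀ hr.ne', one_mul]
    _ ≤ Real.sqrt (-t) * (C₀ / (Real.sqrt (-t) * ‖y‖ + Real.sqrt (-t))) :=
        mul_le_mul_of_nonneg_left key hr.le
    _ = C₀ / (1 + ‖y‖) := by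
        rw [show Real.sqrt (-t) * ‖y‖ + Real.sqrt (-t) = Real.sqrt (-t) * (1 + ‖y‖) by ring,
          mul_div_assoc', mul_div_mul_left _ _ hr.ne']

/-- **Step 1, (1.10) ⇒ (1.9) for `s ≥ 0`** (Remark 1.2 / Lemma 7.1, first assertion, p. 24): under
the Type I bound (1.10) on `ℝ³ × [−1,0)` and the ansatz (1.13a), the profile obeys
`|U(y,s)| ≤ C₀/(1+|y|)` for all `y` and all self-similar times `s ≥ 0` (the times
`t = −e^{−s} ∈ [−1,0)`), with the SAME constant `C₀`.
[cite: PineauVicol2026, Remark 1.2 (p. 3) and Lemma 7.1 (pp. 23–24)] -/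
theorem norm_profile_le_of_typeI
    (hI : ∀ t ∈ Ico (-1 : ℝ) 0, ∀ x, ‖u t x‖ ≤ C₀ / (‖x‖ + Real.sqrt (-t)))
    (hA : ∀ t ∈ Ico (-1 : ℝ) 0, ∀ x, u t x = pvAnsatz α U t x)
    (y : EuclideanSpace ℝ (Fin 3)) {s : ℝ} (hs : 0 ≤ s) : ‖U y s‖ ≤ C₀ / (1 + ‖y‖) := by
  have ht : -Real.exp (-s) ∈ Ico (-1 : ℝ) 0 := by
    refine ⟨?_, ?_⟩
    · have : Real.exp (-s) ≤ 1 := Real.exp_le_one_iff.2 (by linarith)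
      linarith
    · have := Real.exp_pos (-s)
      linarith
  have h := norm_profile_le_of_typeI_slice hI hA ht y
  rwa [neg_neg, Real.log_exp, neg_neg] at h

/-- An `S`-periodic profile repeats after `n` periods: `U(y, s + nS) = U(y, s)`. [folklore] -/
theorem profile_add_nat_mul_period {S : ℝ} (hper : ∀ y s, U y (s + S) = U y s)
    (y : EuclideanSpace ℝ (Fin 3)) (s : ℝ) (n : ℕ) : U y (s + n * S) = U y s := by
  induction n with
  | zero => simp
  | succ n ih =>
    have : s + ((n + 1 : ℕ) : ℝ) * S = (s + n * S) + S := by push_cast; ring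
    rw [this, hper, ih]

/-- **Step 1 under the hypotheses of Theorem 1.7 = Lemma 7.1, first assertion** (p. 23: "the
profile `U(·, s)` satisfies the pointwise bound (1.9) for all `s ∈ [0, S]`, with the same constant
`C_{U,0} > 0` from the Type I upper bound (1.10)"): if `u` obeys (1.10) on `ℝ³ × [−1,0)` and is
`(α, c)`-RDSS with a profile `U` of period `S = 2 log c`, `c > 1` ((1.13a)–(1.13b)), then
`|U(y,s)| ≤ C₀/(1+|y|)` for all `y` and ALL `s` (for `s ≥ 0` by `norm_profile_le_of_typeI`,
for `s < 0` by periodicity). [cite: PineauVicol2026, Lemma 7.1 (pp. 23–24)] -/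
theorem norm_profile_le_of_typeI_periodic {c : ℝ} (hc : 1 < c)
    (hI : ∀ t ∈ Ico (-1 : ℝ) 0, ∀ x, ‖u t x‖ ≤ C₀ / (‖x‖ + Real.sqrt (-t)))
    (hper : ∀ y s, U y (s + 2 * Real.log c) = U y s)
    (hA : ∀ t ∈ Ico (-1 : ℝ) 0, ∀ x, u t x = pvAnsatz α U t x)
    (y : EuclideanSpace ℝ (Fin 3)) (s : ℝ) : ‖U y s‖ ≤ C₀ / (1 + ‖y‖) := by
  have hS : 0 < 2 * Real.log c := by
    have := Real.log_pos hc
    linarith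
  obtain ⟨n, hn⟩ := exists_nat_ge (-s / (2 * Real.log c))
  have hs' : 0 ≤ s + n * (2 * Real.log c) := by
    have : -s ≤ n * (2 * Real.log c) := by rwa [div_le_iff₀ hS] at hn
    linarith
  rw [← profile_add_nat_mul_period hper y s n]
  exact norm_profile_le_of_typeI hI hA y hs'

/-- **Step 1, converse: (1.9) for `s ≥ 0` ⇒ (1.10)** (Remark 1.2, pp. 3–4: "Using the ansatz
(1.7), it is immediate to show the global bound (1.9) is equivalent (within this class of rotated
backwards self-similar solutions) to the borderline Type I blowup rate (1.10) … The constants in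
(1.9) and (1.10) are the same"): if the profile obeys `|U(y,s)| ≤ C₀/(1+|y|)` for all `y` and all
`s ≥ 0`, then the ansatz field (1.13a) obeys `|u(x,t)| ≤ C₀/(|x| + √(−t))` on `ℝ³ × [−1,0)`.
[cite: PineauVicol2026, Remark 1.2 (pp. 3–4)] -/
theorem typeI_of_norm_profile_le (hU : ∀ y s, 0 ≤ s → ‖U y s‖ ≤ C₀ / (1 + ‖y‖)) :
    ∀ t ∈ Ico (-1 : ℝ) 0, ∀ x, ‖pvAnsatz α U t x‖ ≤ C₀ / (‖x‖ + Real.sqrt (-t)) := by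
  intro t ht x
  have hr : 0 < Real.sqrt (-t) := Real.sqrt_pos.2 (by linarith [ht.2])
  have hs : 0 ≤ -Real.log (-t) := by
    rw [neg_nonneg]
    exact Real.log_nonpos (by linarith [ht.2]) (by linarith [ht.1])
  rw [norm_pvAnsatz]
  have hy := hU (rotZ (-(α * -Real.log (-t))) ((Real.sqrt (-t))⁻¹ • x)) _ hs
  rw [norm_rotZ, norm_smul, norm_inv, Real.norm_of_nonneg hr.le] at hy
  have h1 : ‖x‖ + Real.sqrt (-t) ≠ 0 := by positivity
  have h2 : 1 + (Real.sqrt (-t))⁻¹ * ‖x‖ ≠ 0 := by positivity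
  have h3 : Real.sqrt (-t) ≠ 0 := hr.ne'
  calc (Real.sqrt (-t))⁻¹ *
        ‖U (rotZ (-(α * -Real.log (-t))) ((Real.sqrt (-t))⁻¹ • x)) (-Real.log (-t))‖
      ≤ (Real.sqrt (-t))⁻¹ * (C₀ / (1 + (Real.sqrt (-t))⁻¹ * ‖x‖)) :=
        mul_le_mul_of_nonneg_left hy (inv_nonneg.2 hr.le)
    _ = C₀ / (‖x‖ + Real.sqrt (-t)) := by
        field_simp
        ring

/-- **Remark 1.2 for rotated self-similar profiles (the setting of Theorem 1.4).** For a
time-independent profile `U : ℝ³ → ℝ³` and any angular speed `α`, the RSS field (1.7)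
`u(x,t) = (−t)^{−1/2} R(αs) U(R(−αs)x/√(−t))` obeys the Type I bound (1.10) with constant `C₀`
on `ℝ³ × [−1,0)` if and only if the profile obeys (1.9), `|U(y)| ≤ C₀/(1+|y|)`, with the same
`C₀` ("The constants in (1.9) and (1.10) are the same"). [cite: PineauVicol2026, Remark 1.2 (pp. 3–4)] -/
theorem typeI_iff_norm_profile_le_rss {V : EuclideanSpace ℝ (Fin 3) → EuclideanSpace ℝ (Fin 3)} :
    (∀ t ∈ Ico (-1 : ℝ) 0, ∀ x,
        ‖pvAnsatz α (fun y _ => V y) t x‖ ≤ C₀ / (‖x‖ + Real.sqrt (-t))) ↔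
      ∀ y, ‖V y‖ ≤ C₀ / (1 + ‖y‖) := by
  constructor
  · intro hI y
    exact norm_profile_le_of_typeI (u := pvAnsatz α (fun y _ => V y)) (U := fun y _ => V y) hI
      (fun _ _ _ => rfl) y le_rfl
  · intro hV
    exact typeI_of_norm_profile_le (U := fun y _ => V y) fun y _ _ => hV y

/-! ### The profile slices in terms of the physical field; incompressibility (1.14b) -/

/-- **Inverting the ansatz on a time slice.** If `u` is given by (1.13a) on `[−1,0)`, then for
`t ∈ [−1,0)`, `s = −log(−t)`: `U(y,s) = √(−t) R(−αs) u(√(−t) R(αs) y, t)` (the rotations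
`R(±αs)` as continuous linear maps `rotZL`).
[cite: PineauVicol2026, (1.13a) (p. 7) and proof of Lemma 7.1 (p. 24)] -/
theorem profile_slice_eq (hA : ∀ t ∈ Ico (-1 : ℝ) 0, ∀ x, u t x = pvAnsatz α U t x)
    {t : ℝ} (ht : t ∈ Ico (-1 : ℝ) 0) (y : EuclideanSpace ℝ (Fin 3)) :
    U y (-Real.log (-t)) = Real.sqrt (-t) •
      rotZL (-(α * -Real.log (-t))) (u t (Real.sqrt (-t) • rotZL (α * -Real.log (-t)) y)) := by
  have hr : 0 < Real.sqrt (-t) := Real.sqrt_pos.2 (by linarith [ht.2])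
  rw [hA t ht (Real.sqrt (-t) • rotZL (α * -Real.log (-t)) y)]
  simp only [pvAnsatz]
  rw [inv_smul_smul₀ hr.ne', rotZL_apply (α * -Real.log (-t)) y, ← rotZ_add, neg_add_cancel,
    rotZ_zero, map_smul, smul_inv_smul₀ hr.ne', rotZL_apply, ← rotZ_add, neg_add_cancel, rotZ_zero]

/-- **Incompressibility of the profile slices** (the second equation (1.14b), `∇·U = 0`, of the
profile system, from `∇·u = 0` (1.1b) through the ansatz (1.13a): with
`U(·,s) = √(−t) R(−αs) ∘ u(·,t) ∘ (√(−t) R(αs))`, `div U(·,s)(y) = (−t) · div u(·,t)(x)`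
because the trace is invariant under conjugation by the rotation).
[cite: PineauVicol2026, (1.14b) (p. 7)] -/
theorem isDivFree_profile_slice (hA : ∀ t ∈ Ico (-1 : ℝ) 0, ∀ x, u t x = pvAnsatz α U t x)
    {t : ℝ} (ht : t ∈ Ico (-1 : ℝ) 0) (hd : Differentiable ℝ (u t))
    (hdiv : VectorCalculus.IsDivFree (u t)) :
    VectorCalculus.IsDivFree (fun y => U y (-Real.log (-t))) := by
  intro y
  obtain ⟨A, hAdef⟩ : ∃ A : EuclideanSpace ℝ (Fin 3) →L[ℝ] EuclideanSpace ℝ (Fin 3),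
      A = Real.sqrt (-t) • rotZL (α * -Real.log (-t)) := ⟨_, rfl⟩
  obtain ⟨B, hBdef⟩ : ∃ B : EuclideanSpace ℝ (Fin 3) →L[ℝ] EuclideanSpace ℝ (Fin 3),
      B = Real.sqrt (-t) • rotZL (-(α * -Real.log (-t))) := ⟨_, rfl⟩
  have hfun : (fun y => U y (-Real.log (-t))) = fun y => B (u t (A y)) := by
    funext z
    rw [profile_slice_eq hA ht z, hAdef, hBdef]
    rfl
  have hderiv :
      HasFDerivAt (fun y => B (u t (A y))) (B.comp ((fderiv ℝ (u t) (A y)).comp A)) y :=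
    B.hasFDerivAt.comp y ((hd (A y)).hasFDerivAt.comp y A.hasFDerivAt)
  have hAB : A.comp B = (Real.sqrt (-t) * Real.sqrt (-t)) •
      ContinuousLinearMap.id ℝ (EuclideanSpace ℝ (Fin 3)) := by
    rw [hAdef, hBdef, ContinuousLinearMap.smul_comp, ContinuousLinearMap.comp_smul, smul_smul,
      rotZL_comp_neg]
  have hAB' : (A : EuclideanSpace ℝ (Fin 3) →ₗ[ℝ] EuclideanSpace ℝ (Fin 3)) ∘ₗ
      (B : EuclideanSpace ℝ (Fin 3) →ₗ[ℝ] EuclideanSpace ℝ (Fin 3)) =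
      (Real.sqrt (-t) * Real.sqrt (-t)) • LinearMap.id := by
    have h := congrArg
      (fun f : EuclideanSpace ℝ (Fin 3) →L[ℝ] EuclideanSpace ℝ (Fin 3) =>
        (f : EuclideanSpace ℝ (Fin 3) →ₗ[ℝ] EuclideanSpace ℝ (Fin 3))) hAB
    simpa using h
  rw [VectorCalculus.divergence, hfun, hderiv.fderiv]
  change LinearMap.trace ℝ (EuclideanSpace ℝ (Fin 3))
    ((B : EuclideanSpace ℝ (Fin 3) →ₗ[ℝ] EuclideanSpace ℝ (Fin 3)) ∘ₗ
      ((fderiv ℝ (u t) (A y) : EuclideanSpace ℝ (Fin 3) →ₗ[ℝ] EuclideanSpace ℝ (Fin 3)) ∘ₗ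
        (A : EuclideanSpace ℝ (Fin 3) →ₗ[ℝ] EuclideanSpace ℝ (Fin 3)))) = 0
  rw [LinearMap.trace_comp_comm', LinearMap.comp_assoc, hAB', LinearMap.comp_smul, map_smul,
    LinearMap.comp_id]
  have h0 := hdiv (A y)
  rw [VectorCalculus.divergence] at h0
  rw [h0, smul_zero]

/-! ### The endgame of §7.5: vanishing profile vorticity forces a vanishing profile -/

/-- **Liouville step** (end of the proof of Prop. 3.1, p. 11: "if `Ω ≡ 0`, then since `∇·U = 0`
we have that `U` is a harmonic function which vanishes at infinity by (1.9); thus `U ≡ 0`";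
§7.5, p. 27): a `C²` field on `ℝ³` with `curl V = 0`, `div V = 0` and the decay
`|V(y)| ≤ C₀/(1+|y|)` vanishes identically (it is bounded, hence constant by
`eq_of_curl_eq_zero_of_isDivFree_of_bounded`, and the constant decays to `0`).
[cite: PineauVicol2026, proof of Proposition 3.1, last paragraph (p. 11)] -/
theorem eq_zero_of_curl_eq_zero_of_isDivFree_of_norm_le
    {V : EuclideanSpace ℝ (Fin 3) → EuclideanSpace ℝ (Fin 3)} (hV : ContDiff ℝ 2 V)
    (hcurl : ∀ y, curl V y = 0) (hdiv : VectorCalculus.IsDivFree V)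
    (hb : ∀ y, ‖V y‖ ≤ C₀ / (1 + ‖y‖)) : V = 0 := by
  have hC₀ : 0 ≤ C₀ := by
    have h := (norm_nonneg _).trans (hb 0)
    simpa using h
  have hM : ∀ y, ‖V y‖ ≤ C₀ := fun y =>
    (hb y).trans (div_le_self hC₀ (by linarith [norm_nonneg y]))
  have hconst := eq_of_curl_eq_zero_of_isDivFree_of_bounded hV hcurl hdiv hM
  funext x
  simp only [Pi.zero_apply]
  by_contra hx
  have hpos : 0 < ‖V x‖ := norm_pos_iff.2 hx
  obtain ⟨n, hn⟩ := exists_nat_gt (C₀ / ‖V x‖)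
  -- a point at distance `≥ n` from the origin
  obtain ⟨w, hw⟩ : ∃ w : EuclideanSpace ℝ (Fin 3), (n : ℝ) ≤ ‖w‖ := by
    refine ⟨(n : ℝ) • EuclideanSpace.single (0 : Fin 3) (1 : ℝ), ?_⟩
    have h := PiLp.norm_apply_le
      ((n : ℝ) • EuclideanSpace.single (0 : Fin 3) (1 : ℝ) : EuclideanSpace ℝ (Fin 3)) 0
    have h0 : ((n : ℝ) • EuclideanSpace.single (0 : Fin 3) (1 : ℝ) : EuclideanSpace ℝ (Fin 3)) 0
        = n := by simp
    rwa [h0, Real.norm_of_nonneg (Nat.cast_nonneg n)] at h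
  have h1 : ‖V x‖ ≤ C₀ / (1 + n) := by
    have h := hb w
    rw [← hconst x] at h
    exact h.trans (div_le_div_of_nonneg_left hC₀ (by positivity) (by linarith))
  rw [le_div_iff₀ (by positivity)] at h1
  rw [div_lt_iff₀ hpos] at hn
  nlinarith

/-- **Reduction of Theorem 1.7 to the vanishing of the profile vorticity, one slice** (§7.5,
p. 27: "Hence `Ω ≡ 0` on `ℝ³ × [0,S]`. Since `∇·U(·,s) = 0`, `∇×U(·,s) = Ω(·,s) = 0`, and
`U(·,s) ∈ L⁴(ℝ³)` for each `s`, we obtain that `U ≡ 0` on `ℝ³ × [0,S]`"): for a classical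
solution `(u,p)` on `[−1,0)` obeying the Type I bound (1.10) and the ansatz (1.13a) with a `C²`
profile `U`, if the profile slice at a self-similar time `s ≥ 0` is irrotational,
`curl U(·,s) = 0`, then `U(·,s) ≡ 0` (incompressibility from (1.1b) by
`isDivFree_profile_slice`, decay (1.9) by `norm_profile_le_of_typeI`, then the Liouville step).
[cite: PineauVicol2026, §7.5, end of the proof of Theorem 1.7 for small |α| (p. 27)] -/
theorem profile_slice_eq_zero_of_curl_eq_zero {p : ℝ → EuclideanSpace ℝ (Fin 3) → ℝ}
    (hsol : IsClassicalNSSolutionOn (Ico (-1) 0) 1 0 u p)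
    (hI : ∀ t ∈ Ico (-1 : ℝ) 0, ∀ x, ‖u t x‖ ≤ C₀ / (‖x‖ + Real.sqrt (-t)))
    (hU : ContDiff ℝ 2 (fun q : EuclideanSpace ℝ (Fin 3) × ℝ => U q.1 q.2))
    (hA : ∀ t ∈ Ico (-1 : ℝ) 0, ∀ x, u t x = pvAnsatz α U t x)
    {s : ℝ} (hs : 0 ≤ s) (hΩ : ∀ y, curl (fun z => U z s) y = 0)
    (y : EuclideanSpace ℝ (Fin 3)) : U y s = 0 := by
  have ht : -Real.exp (-s) ∈ Ico (-1 : ℝ) 0 := by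
    refine ⟨?_, ?_⟩
    · have : Real.exp (-s) ≤ 1 := Real.exp_le_one_iff.2 (by linarith)
      linarith
    · have := Real.exp_pos (-s)
      linarith
  have hst : -Real.log (-(-Real.exp (-s))) = s := by rw [neg_neg, Real.log_exp, neg_neg]
  have hV : ContDiff ℝ 2 (fun z => U z s) := hU.comp (contDiff_id.prodMk contDiff_const)
  have hd : Differentiable ℝ (u (-Real.exp (-s))) :=
    (hsol.contDiff_velocity ht).differentiable (by simp)
  have hdiv : VectorCalculus.IsDivFree (fun z => U z s) := by
    have h := isDivFree_profile_slice hA ht hd (hsol.divFree _ ht)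
    rwa [hst] at h
  have hb : ∀ z, ‖U z s‖ ≤ C₀ / (1 + ‖z‖) := fun z => norm_profile_le_of_typeI hI hA z hs
  exact congrFun (eq_zero_of_curl_eq_zero_of_isDivFree_of_norm_le hV hΩ hdiv hb) y

/-- **Reduction of Theorem 1.7 to the vanishing of the profile vorticity on `ℝ³ × [0,S]`**
(§7.5, p. 27, last paragraph; likewise §8, p. 29: "we deduce that `Ω ≡ 0`, completing the
proof"): under the hypotheses of `pineauVicol2026_rdss_liouville` on `(u, p, U)`, if
`curl U(·,s) ≡ 0` for every `s ∈ [0, 2 log c]` then `U ≡ 0` on `ℝ³ × [0, 2 log c]` — the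
printed conclusion. What remains of the printed proof is exactly the enstrophy argument
`Ω ≡ 0` (Lemma 7.1's derivative bounds, Prop. 5.1, (7.10)–(7.12)).
[cite: PineauVicol2026, §7.5 (p. 27) and §8 (p. 29), last paragraphs] -/
theorem rdss_profile_eq_zero_of_curl_eq_zero {c : ℝ} {p : ℝ → EuclideanSpace ℝ (Fin 3) → ℝ}
    (hsol : IsClassicalNSSolutionOn (Ico (-1) 0) 1 0 u p)
    (hI : ∀ t ∈ Ico (-1 : ℝ) 0, ∀ x, ‖u t x‖ ≤ C₀ / (‖x‖ + Real.sqrt (-t)))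
    (hU : ContDiff ℝ 2 (fun q : EuclideanSpace ℝ (Fin 3) × ℝ => U q.1 q.2))
    (hA : ∀ t ∈ Ico (-1 : ℝ) 0, ∀ x, u t x = pvAnsatz α U t x)
    (hΩ : ∀ s ∈ Icc (0 : ℝ) (2 * Real.log c), ∀ y, curl (fun z => U z s) y = 0) :
    ∀ y, ∀ s ∈ Icc (0 : ℝ) (2 * Real.log c), U y s = 0 :=
  fun y s hs => profile_slice_eq_zero_of_curl_eq_zero hsol hI hU hA hs.1 (hΩ s hs) y


/-! ### Lemma 4.1: the error term `E` is an angular derivative -/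

/-- `‖J y‖ ≤ ‖y‖` for the infinitesimal rotation `J y = (−y₁, y₀, 0)` (`rotGen`). [folklore] -/
theorem norm_rotGen_le (y : EuclideanSpace ℝ (Fin 3)) : ‖rotGen y‖ ≤ ‖y‖ := by
  rw [EuclideanSpace.norm_eq, EuclideanSpace.norm_eq]
  apply Real.sqrt_le_sqrt
  simp only [Fin.sum_univ_three, Real.norm_eq_abs, sq_abs, rotGen_apply_zero, rotGen_apply_one,
    rotGen_apply_two]
  nlinarith [sq_nonneg (y 2)]

/-- **Lemma 4.1, identity (4.6).** For a profile `U` differentiable at `y`, Pineau–Vicol's error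
term (4.4), `E(y) = ½ (y₁U₂ − y₂U₁) + (U(y) + ½ y)·(y₁∂₂U − y₂∂₁U)` — here with the
infinitesimal rotation `J = rotGen` (`J y = (−y₂, y₁, 0)` in the paper's indices `1,2,3`), so that
`y₁U₂ − y₂U₁ = ⟪J y, U⟫` and `y₁∂₂ − y₂∂₁ = ∂_θ = (J y)·∇` — equals `½ ∂_θ(|U|² + U·y)`:
"The observation that `E` is a pure `∂_θ` derivative (4.6) is crucial for dealing with the large
`α` regime". [cite: PineauVicol2026, Lemma 4.1 (4.6) (p. 12)] -/
theorem errorTerm_eq_half_dtheta {U : EuclideanSpace ℝ (Fin 3) → EuclideanSpace ℝ (Fin 3)}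
    {y : EuclideanSpace ℝ (Fin 3)} (hU : DifferentiableAt ℝ U y) :
    (1 / 2 : ℝ) * ⟪rotGen y, U y⟫ + ⟪U y + (1 / 2 : ℝ) • y, fderiv ℝ U y (rotGen y)⟫ =
      (1 / 2 : ℝ) * fderiv ℝ (fun z => ‖U z‖ ^ 2 + ⟪U z, z⟫) y (rotGen y) := by
  have h1 : HasFDerivAt (fun z => ‖U z‖ ^ 2) (2 • (innerSL ℝ (U y)).comp (fderiv ℝ U y)) y :=
    hU.hasFDerivAt.norm_sq
  have h2 : HasFDerivAt (fun z => ⟪U z, z⟫)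
      ((fderivInnerCLM ℝ (U y, y)).comp
        ((fderiv ℝ U y).prod (ContinuousLinearMap.id ℝ (EuclideanSpace ℝ (Fin 3))))) y :=
    hU.hasFDerivAt.inner ℝ (hasFDerivAt_id y)
  have h12 : HasFDerivAt (fun z => ‖U z‖ ^ 2 + ⟪U z, z⟫)
      (2 • (innerSL ℝ (U y)).comp (fderiv ℝ U y) + (fderivInnerCLM ℝ (U y, y)).comp
        ((fderiv ℝ U y).prod (ContinuousLinearMap.id ℝ (EuclideanSpace ℝ (Fin 3))))) y :=
    h1.add h2
  rw [h12.fderiv]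
  simp only [add_apply, FunLike.coe_smul, Pi.smul_apply,
    ContinuousLinearMap.comp_apply, innerSL_apply_apply, fderivInnerCLM_apply,
    ContinuousLinearMap.prod_apply, ContinuousLinearMap.id_apply]
  rw [inner_add_left, real_inner_smul_left, real_inner_comm (rotGen y) (U y),
    real_inner_comm y (fderiv ℝ U y (rotGen y))]
  ring

/-- **Lemma 4.1, bound (4.5).** Under the profile bound (1.9), `|U(y)| ≤ C₀/(1+|y|)`, and the
gradient bound (2.1), `|∇U(y)| ≤ C₁/(1+|y|²)` (operator norm of `DU(y)`), the error term (4.4)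
obeys `|E(y)| ≤ C_E := C₀ + C₁ + 2 C₀ C₁` ("The bound (1.9) and (2.1) imply
`|E(y)| ≤ C_{U,0} + C_{U,1} + 2(1+|y|²)^{−1} C_{U,0} C_{U,1}`. The bound (4.5) then follows").
[cite: PineauVicol2026, Lemma 4.1 (4.5) (p. 12)] -/
theorem abs_errorTerm_le {U : EuclideanSpace ℝ (Fin 3) → EuclideanSpace ℝ (Fin 3)}
    {y : EuclideanSpace ℝ (Fin 3)} {C₀ C₁ : ℝ}
    (h0 : ‖U y‖ ≤ C₀ / (1 + ‖y‖)) (h1 : ‖fderiv ℝ U y‖ ≤ C₁ / (1 + ‖y‖ ^ 2)) :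
    |(1 / 2 : ℝ) * ⟪rotGen y, U y⟫ + ⟪U y + (1 / 2 : ℝ) • y, fderiv ℝ U y (rotGen y)⟫| ≤
      C₀ + C₁ + 2 * C₀ * C₁ := by
  -- abbreviations: `r = |y|`, `a = |U(y)|`, `d = |DU(y)|`
  have hr : 0 ≤ ‖y‖ := norm_nonneg y
  have ha : 0 ≤ ‖U y‖ := norm_nonneg _
  have hd : 0 ≤ ‖fderiv ℝ U y‖ := norm_nonneg _
  have hr1 : 0 < 1 + ‖y‖ := by positivity
  have hr2 : 0 < 1 + ‖y‖ ^ 2 := by positivity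
  -- the two bounds in product form
  have h0' : ‖U y‖ * (1 + ‖y‖) ≤ C₀ := (le_div_iff₀ hr1).1 h0
  have h1' : ‖fderiv ℝ U y‖ * (1 + ‖y‖ ^ 2) ≤ C₁ := (le_div_iff₀ hr2).1 h1
  have hC₀ : 0 ≤ C₀ := le_trans (by positivity) h0'
  have hC₁ : 0 ≤ C₁ := le_trans (by positivity) h1'
  -- first term
  have hJ : ‖rotGen y‖ ≤ ‖y‖ := norm_rotGen_le y
  have hT1 : |(1 / 2 : ℝ) * ⟪rotGen y, U y⟫| ≤ (1 / 2 : ℝ) * C₀ := by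
    rw [abs_mul, abs_of_pos (by norm_num : (0 : ℝ) < 1 / 2)]
    refine mul_le_mul_of_nonneg_left ?_ (by norm_num)
    calc |⟪rotGen y, U y⟫| ≤ ‖rotGen y‖ * ‖U y‖ := abs_real_inner_le_norm _ _
      _ ≤ ‖y‖ * ‖U y‖ := mul_le_mul_of_nonneg_right hJ ha
      _ ≤ (1 + ‖y‖) * ‖U y‖ := mul_le_mul_of_nonneg_right (by linarith) ha
      _ ≤ C₀ := by rw [mul_comm]; exact h0'
  -- second term
  have hDJ : ‖fderiv ℝ U y (rotGen y)‖ ≤ ‖fderiv ℝ U y‖ * ‖y‖ :=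
    (ContinuousLinearMap.le_opNorm _ _).trans (mul_le_mul_of_nonneg_left hJ hd)
  have hA1 : ‖U y‖ * ‖y‖ ≤ C₀ :=
    le_trans (mul_le_mul_of_nonneg_left (by linarith : ‖y‖ ≤ 1 + ‖y‖) ha) h0'
  have hA2 : ‖fderiv ℝ U y‖ ≤ C₁ :=
    le_trans (le_mul_of_one_le_right hd (by nlinarith : (1 : ℝ) ≤ 1 + ‖y‖ ^ 2)) h1'
  have hA3 : ‖fderiv ℝ U y‖ * ‖y‖ ^ 2 ≤ C₁ :=
    le_trans (mul_le_mul_of_nonneg_left (by nlinarith : ‖y‖ ^ 2 ≤ 1 + ‖y‖ ^ 2) hd) h1'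
  have hT2 : |⟪U y + (1 / 2 : ℝ) • y, fderiv ℝ U y (rotGen y)⟫| ≤
      C₀ * C₁ + (1 / 2 : ℝ) * C₁ := by
    calc |⟪U y + (1 / 2 : ℝ) • y, fderiv ℝ U y (rotGen y)⟫|
        ≤ ‖U y + (1 / 2 : ℝ) • y‖ * ‖fderiv ℝ U y (rotGen y)‖ := abs_real_inner_le_norm _ _
      _ ≤ (‖U y‖ + (1 / 2 : ℝ) * ‖y‖) * (‖fderiv ℝ U y‖ * ‖y‖) := by
          refine mul_le_mul ?_ hDJ (norm_nonneg _) (by positivity)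
          calc ‖U y + (1 / 2 : ℝ) • y‖ ≤ ‖U y‖ + ‖(1 / 2 : ℝ) • y‖ := norm_add_le _ _
            _ = ‖U y‖ + (1 / 2 : ℝ) * ‖y‖ := by
                rw [norm_smul, Real.norm_of_nonneg (by norm_num : (0 : ℝ) ≤ 1 / 2)]
      _ = (‖U y‖ * ‖y‖) * ‖fderiv ℝ U y‖ + (1 / 2 : ℝ) * (‖fderiv ℝ U y‖ * ‖y‖ ^ 2) := by
          ring
      _ ≤ C₀ * C₁ + (1 / 2 : ℝ) * C₁ :=
          add_le_add (mul_le_mul hA1 hA2 hd hC₀) (mul_le_mul_of_nonneg_left hA3 (by norm_num))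
  calc |(1 / 2 : ℝ) * ⟪rotGen y, U y⟫ + ⟪U y + (1 / 2 : ℝ) • y, fderiv ℝ U y (rotGen y)⟫|
      ≤ |(1 / 2 : ℝ) * ⟪rotGen y, U y⟫| + |⟪U y + (1 / 2 : ℝ) • y, fderiv ℝ U y (rotGen y)⟫| :=
        abs_add_le _ _
    _ ≤ (1 / 2 : ℝ) * C₀ + (C₀ * C₁ + (1 / 2 : ℝ) * C₁) := add_le_add hT1 hT2
    _ ≤ C₀ + C₁ + 2 * C₀ * C₁ := by nlinarith [mul_nonneg hC₀ hC₁]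

/-! ### Lemma 7.2: the time fluctuation of a periodic profile is linearly small in the period -/

/-- **Mean-value form of Lemma 7.2** (p. 25: "Since `⟨Ũ⟩_s = 0`, we may write
`Ũ(·,s) = S⁻¹ ∫₀^S (U(·,s) − U(·,s′)) ds′ …`, whence `|Ũ(·,s)| ≤ S sup_τ |∂_τ U|`"), for a
curve `f : ℝ → F` in a real Banach space: if `f` is continuous on `[0,S]`, `S > 0`, and
`‖f τ − f τ′‖ ≤ K |τ − τ′|` on `[0,S]`, then the fluctuation from the time average obeys
`‖f(s) − ⨍_{[0,S]} f‖ ≤ K S` for `s ∈ [0,S]`. [cite: PineauVicol2026, proof of Lemma 7.2 (p. 25)] -/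
theorem norm_sub_setAverage_le {F : Type*} [NormedAddCommGroup F] [NormedSpace ℝ F]
    [CompleteSpace F] {f : ℝ → F} {S K : ℝ} (hS : 0 < S) (hf : ContinuousOn f (Icc 0 S))
    (hK : ∀ τ ∈ Icc 0 S, ∀ τ' ∈ Icc 0 S, ‖f τ - f τ'‖ ≤ K * |τ - τ'|)
    {s : ℝ} (hs : s ∈ Icc 0 S) : ‖f s - ⨍ τ in Icc 0 S, f τ‖ ≤ K * S := by
  have hvol : volume (Icc 0 S) = ENNReal.ofReal S := by rw [Real.volume_Icc, sub_zero]
  have hvolR : volume.real (Icc 0 S) = S := by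
    rw [measureReal_def, hvol, ENNReal.toReal_ofReal hS.le]
  have hint : IntegrableOn f (Icc 0 S) := hf.integrableOn_Icc
  have hconst : IntegrableOn (fun _ : ℝ => f s) (Icc 0 S) := continuousOn_const.integrableOn_Icc
  have hK0 : 0 ≤ K := by
    have h := hK S (right_mem_Icc.2 hS.le) 0 (left_mem_Icc.2 hS.le)
    rw [sub_zero, abs_of_pos hS] at h
    nlinarith [norm_nonneg (f S - f 0)]
  -- `f s - ⨍ f = S⁻¹ • ∫ (f s - f τ) dτ`
  have hrepr : f s - ⨍ τ in Icc 0 S, f τ = S⁻¹ • ∫ τ in Icc 0 S, (f s - f τ) := by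
    rw [setAverage_eq, hvolR, integral_sub hconst hint, setIntegral_const, hvolR, smul_sub,
      smul_smul, inv_mul_cancel₀ hS.ne', one_smul]
  rw [hrepr, norm_smul, norm_inv, Real.norm_of_nonneg hS.le]
  have hbound : ‖∫ τ in Icc 0 S, (f s - f τ)‖ ≤ (K * S) * volume.real (Icc 0 S) := by
    refine norm_setIntegral_le_of_norm_le_const (by simp [hvol]) (fun τ hτ => ?_)
    refine (hK s hs τ hτ).trans (mul_le_mul_of_nonneg_left ?_ hK0)
    rw [abs_le]
    constructor <;> linarith [hs.1, hs.2, hτ.1, hτ.2]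
  rw [hvolR] at hbound
  calc S⁻¹ * ‖∫ τ in Icc 0 S, (f s - f τ)‖ ≤ S⁻¹ * (K * S * S) :=
        mul_le_mul_of_nonneg_left hbound (inv_nonneg.2 hS.le)
    _ = K * S := by field_simp

/-- **Lemma 7.2, (7.5), first bound** (p. 24–25): if the profile `U(y, ·)` is differentiable in
the self-similar time with `|∂_s U(y,s)| ≤ C_{U,s}/(1+|y|)` on `[0,S]` ((7.1), first bound),
then its fluctuation from the time mean `⟨U⟩_s(y) = S⁻¹∫₀^S U(y,s′) ds′` (7.4) obeys
`|Ũ(y,s)| = |U(y,s) − ⟨U⟩_s(y)| ≤ C_{U,s} S/(1+|y|)` for `s ∈ [0,S]` — "the fluctuation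
`Ũ = U − ⟨U⟩_s` is linearly small in the period". [cite: PineauVicol2026, Lemma 7.2 (7.5) (pp. 24–25)] -/
theorem norm_fluctuation_le {U : EuclideanSpace ℝ (Fin 3) → ℝ → EuclideanSpace ℝ (Fin 3)}
    {S C : ℝ} (hS : 0 < S)
    (hdiff : ∀ y, ∀ τ ∈ Icc 0 S, DifferentiableAt ℝ (fun σ => U y σ) τ)
    (hder : ∀ y, ∀ τ ∈ Icc 0 S, ‖deriv (fun σ => U y σ) τ‖ ≤ C / (1 + ‖y‖))
    (y : EuclideanSpace ℝ (Fin 3)) {s : ℝ} (hs : s ∈ Icc 0 S) :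
    ‖U y s - ⨍ τ in Icc 0 S, U y τ‖ ≤ C * S / (1 + ‖y‖) := by
  have hcont : ContinuousOn (fun σ => U y σ) (Icc 0 S) := fun τ hτ =>
    (hdiff y τ hτ).continuousAt.continuousWithinAt
  have hlip : ∀ τ ∈ Icc 0 S, ∀ τ' ∈ Icc 0 S, ‖U y τ - U y τ'‖ ≤ C / (1 + ‖y‖) * |τ - τ'| := by
    intro τ hτ τ' hτ'
    have h := (convex_Icc 0 S).norm_image_sub_le_of_norm_deriv_le (hdiff y) (hder y) hτ' hτ
    simpa [Real.norm_eq_abs] using h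
  have h := norm_sub_setAverage_le hS hcont hlip hs
  calc ‖U y s - ⨍ τ in Icc 0 S, U y τ‖ ≤ C / (1 + ‖y‖) * S := h
    _ = C * S / (1 + ‖y‖) := by ring


/-! ### Periodicity in the self-similar time kills the `∂_s`-term ((7.10), p. 26) -/

/-- Over one period, the integral of the derivative of a periodic function vanishes:
`∫₀^S g' = g(S) − g(0) = 0`. [folklore] -/
theorem intervalIntegral_deriv_eq_zero_of_periodic {g g' : ℝ → ℝ} {S : ℝ}
    (hg : ∀ s, HasDerivAt g (g' s) s) (hg' : Continuous g') (hper : g S = g 0) :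
    ∫ s in (0 : ℝ)..S, g' s = 0 := by
  rw [intervalIntegral.integral_eq_sub_of_hasDerivAt (fun s _ => hg s) (hg'.intervalIntegrable _ _),
    hper, sub_self]

/-- **The time-derivative term of (7.7) integrates to zero over a period** (p. 26: "The
periodicity in `s` of the profile `U` is now used to make the last term in the above identity
disappear, upon integration in `s`"): if `s ↦ U(y,s)` is `C¹` with derivative `U_s(y,s)` and
`S`-periodic, then for every `y`,
`∫₀^S ⟪U(y,s) + ½y, U_s(y,s)⟫ ds = ∫₀^S ∂_s(½|U|² + ½ y·U) ds = 0`.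
[cite: PineauVicol2026, §7.4, derivation of (7.10) (p. 26)] -/
theorem intervalIntegral_inner_add_half_smul_deriv_eq_zero {F : Type*} [NormedAddCommGroup F]
    [InnerProductSpace ℝ F] {V Vs : ℝ → F} {S : ℝ} (y : F)
    (hV : ∀ s, HasDerivAt V (Vs s) s) (hVs : Continuous Vs) (hVc : Continuous V)
    (hper : V S = V 0) :
    ∫ s in (0 : ℝ)..S, ⟪V s + (1 / 2 : ℝ) • y, Vs s⟫ = 0 := by
  -- `⟪V + ½y, V_s⟫ = d/ds (½⟪V, V⟫ + ½⟪y, V⟫)`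
  have hd : ∀ s, HasDerivAt (fun σ => (1 / 2 : ℝ) * ⟪V σ, V σ⟫ + (1 / 2 : ℝ) * ⟪y, V σ⟫)
      (⟪V s + (1 / 2 : ℝ) • y, Vs s⟫) s := by
    intro s
    have h1 : HasDerivAt (fun σ => ⟪V σ, V σ⟫) (⟪V s, Vs s⟫ + ⟪Vs s, V s⟫) s :=
      (hV s).inner ℝ (hV s)
    have h2 : HasDerivAt (fun σ => ⟪y, V σ⟫) (⟪y, Vs s⟫ + ⟪(0 : F), V s⟫) s :=
      (hasDerivAt_const s y).inner ℝ (hV s)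
    have h3 : HasDerivAt (fun σ => (1 / 2 : ℝ) * ⟪V σ, V σ⟫ + (1 / 2 : ℝ) * ⟪y, V σ⟫)
        ((1 / 2 : ℝ) * (⟪V s, Vs s⟫ + ⟪Vs s, V s⟫) +
          (1 / 2 : ℝ) * (⟪y, Vs s⟫ + ⟪(0 : F), V s⟫)) s :=
      HasDerivAt.add (HasDerivAt.const_mul _ h1) (HasDerivAt.const_mul _ h2)
    refine h3.congr_deriv ?_
    rw [inner_add_left, real_inner_smul_left, inner_zero_left, add_zero,
      real_inner_comm (Vs s) (V s)]
    ring
  have hcont : Continuous fun s => ⟪V s + (1 / 2 : ℝ) • y, Vs s⟫ :=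
    (hVc.add continuous_const).inner hVs
  refine intervalIntegral_deriv_eq_zero_of_periodic hd hcont ?_
  simp [hper]

/-- **Integrated against any time-independent weight, the `∂_s`-term vanishes** (the last term
of the displayed identity before (7.10), p. 26: "Here we have crucially used that `w̄` is
independent of `s`"): with `V`, `V_s` as above for every `y`, the iterated integral
`∫ w̄(y) (∫₀^S ⟪U(y,s) + ½y, U_s(y,s)⟫ ds) dy` is zero — no integrability in `y` is needed in
this order of integration. [cite: PineauVicol2026, §7.4, derivation of (7.10) (p. 26)] -/
theorem integral_weight_mul_intervalIntegral_inner_deriv_eq_zero {F : Type*}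
    [NormedAddCommGroup F] [InnerProductSpace ℝ F] [MeasurableSpace F] {μ : Measure F}
    {U Us : F → ℝ → F} {S : ℝ} (w : F → ℝ)
    (hU : ∀ y s, HasDerivAt (fun σ => U y σ) (Us y s) s) (hUs : ∀ y, Continuous fun s => Us y s)
    (hUc : ∀ y, Continuous fun s => U y s) (hper : ∀ y, U y S = U y 0) :
    ∫ y, (w y * ∫ s in (0 : ℝ)..S, ⟪U y s + (1 / 2 : ℝ) • y, Us y s⟫) ∂μ = 0 := by
  have h : ∀ y, ∫ s in (0 : ℝ)..S, ⟪U y s + (1 / 2 : ℝ) • y, Us y s⟫ = 0 := fun y =>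
    intervalIntegral_inner_add_half_smul_deriv_eq_zero y (hU y) (hUs y) (hUc y) (hper y)
  simp only [h, mul_zero, integral_zero]


/-! ### Lemma 7.2, second bound (7.5b): the gradient of the fluctuation -/

section ParametricAverage

variable {H : Type*} [NormedAddCommGroup H] [NormedSpace ℝ H] [ProperSpace H]
  {F : Type*} [NormedAddCommGroup F] [NormedSpace ℝ F]

omit [ProperSpace H] in
/-- The space-partial derivative of a jointly differentiable `U(x, τ)`: the slice `x ↦ U(x, τ)`
has derivative `DǓ(x,τ) ∘ inl` (chain rule with `x ↦ (x, τ)`). [folklore] -/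
theorem hasFDerivAt_slice_left {U : H → ℝ → F} {x : H} {τ : ℝ}
    (hU : DifferentiableAt ℝ (fun p : H × ℝ => U p.1 p.2) (x, τ)) :
    HasFDerivAt (fun z => U z τ)
      ((fderiv ℝ (fun p : H × ℝ => U p.1 p.2) (x, τ)).comp (ContinuousLinearMap.inl ℝ H ℝ)) x := by
  have h : HasFDerivAt ((fun p : H × ℝ => U p.1 p.2) ∘ fun z : H => (z, τ))
      ((fderiv ℝ (fun p : H × ℝ => U p.1 p.2) (x, τ)).comp (ContinuousLinearMap.inl ℝ H ℝ)) x :=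
    HasFDerivAt.comp x hU.hasFDerivAt (hasFDerivAt_prodMk_left x τ)
  exact h

/-- **Differentiation under the period integral** (the step `∇⟨U⟩_s = ⟨∇U⟩_s` implicit in
Lemma 7.2, p. 25: "the claims about `⟨U⟩_s` follow directly from the definition (7.4) and from
Lemma 7.1"): for `U` jointly `C¹` in `(y, τ)`, the time integral `y ↦ ∫_{[0,S]} U(y,τ) dτ` is
differentiable with derivative `∫_{[0,S]} ∇_yU(y,τ) dτ` (dominated differentiation, the bound
coming from continuity of `∇_yU` on the compact `B̄(y,1) × [0,S]`).
[cite: PineauVicol2026, Lemma 7.2 (p. 25), with (7.4)] -/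
theorem hasFDerivAt_setIntegral_Icc {U : H → ℝ → F} {S : ℝ}
    (hU : ContDiff ℝ 1 (fun p : H × ℝ => U p.1 p.2)) (y : H) :
    HasFDerivAt (fun z => ∫ τ in Icc 0 S, U z τ)
      (∫ τ in Icc 0 S, fderiv ℝ (fun z => U z τ) y) y := by
  set V : H × ℝ → F := fun p => U p.1 p.2 with hV
  have hVd : Differentiable ℝ V := hU.differentiable one_ne_zero
  have hVc : Continuous (fderiv ℝ V) := hU.continuous_fderiv one_ne_zero
  -- the space-partial as a jointly continuous function
  set G : H → ℝ → H →L[ℝ] F := fun x τ => (fderiv ℝ V (x, τ)).comp (ContinuousLinearMap.inl ℝ H ℝ)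
    with hG
  have hGd : ∀ x τ, HasFDerivAt (fun z => U z τ) (G x τ) x := fun x τ =>
    hasFDerivAt_slice_left (hVd (x, τ))
  have hGc : Continuous fun p : H × ℝ => G p.1 p.2 := by
    simp only [hG]
    exact (hVc.comp (by fun_prop)).clm_comp continuous_const
  -- a uniform bound on the compact `closedBall y 1 × [0, S]`
  obtain ⟨M, hM⟩ := (isCompact_closedBall y 1 |>.prod isCompact_Icc).exists_bound_of_continuousOn
    (s := closedBall y 1 ×ˢ Icc 0 S) hGc.continuousOn
  have key := hasFDerivAt_integral_of_dominated_of_fderiv_le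
    (μ := volume.restrict (Icc 0 S)) (F := fun x τ => U x τ) (F' := G) (x₀ := y)
    (s := closedBall y 1) (bound := fun _ => M) (closedBall_mem_nhds y one_pos)
    (Eventually.of_forall fun x =>
      ((hU.continuous.comp (by fun_prop : Continuous fun τ : ℝ => (x, τ))).aestronglyMeasurable))
    ((hU.continuous.comp (by fun_prop : Continuous fun τ : ℝ => (y, τ))).continuousOn
      |>.integrableOn_Icc)
    ((hGc.comp (by fun_prop : Continuous fun τ : ℝ => (y, τ))).aestronglyMeasurable)
    ((ae_restrict_mem measurableSet_Icc).mono fun τ hτ x hx => hM (x, τ) ⟨hx, hτ⟩)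
    (continuous_const.continuousOn.integrableOn_Icc)
    (Eventually.of_forall fun τ x _ => hGd x τ)
  refine key.congr_fderiv (setIntegral_congr_fun measurableSet_Icc fun τ _ => ?_)
  exact (hGd y τ).fderiv.symm

/-- The averaged form: `y ↦ ⨍_{[0,S]} U(y,τ) dτ` (the time mean `⟨U⟩_s` of (7.4)) has derivative
`⨍_{[0,S]} ∇_yU(y,τ) dτ`, i.e. `∇⟨U⟩_s = ⟨∇U⟩_s`. [cite: PineauVicol2026, Lemma 7.2 (p. 25), with (7.4)] -/
theorem hasFDerivAt_setAverage_Icc {U : H → ℝ → F} {S : ℝ}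
    (hU : ContDiff ℝ 1 (fun p : H × ℝ => U p.1 p.2)) (y : H) :
    HasFDerivAt (fun z => ⨍ τ in Icc 0 S, U z τ)
      (⨍ τ in Icc 0 S, fderiv ℝ (fun z => U z τ) y) y := by
  simp only [setAverage_eq]
  exact (hasFDerivAt_setIntegral_Icc hU y).const_smul _

omit [ProperSpace H] in
/-- **Mixed partials**: for `U` jointly `C²`, the time derivative of the space gradient of the
slices is the space gradient of the time derivative,
`∂_τ (∇_y U(y, τ)) = ∇_y (∂_τ U)(y, τ)` (symmetry of `D²Ǔ`). [folklore] -/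
theorem hasDerivAt_fderiv_slice {U : H → ℝ → F} (hU : ContDiff ℝ 2 (fun p : H × ℝ => U p.1 p.2))
    (y : H) (τ : ℝ) :
    HasDerivAt (fun σ => fderiv ℝ (fun z => U z σ) y)
      (fderiv ℝ (fun z => fderiv ℝ (fun p : H × ℝ => U p.1 p.2) (z, τ) ((0 : H), (1 : ℝ))) y) τ := by
  set V : H × ℝ → F := fun p => U p.1 p.2 with hV
  have hV1 : ContDiff ℝ 1 (fderiv ℝ V) := hU.fderiv_right le_rfl
  have hVd : Differentiable ℝ V := hU.differentiable (by norm_num)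
  have hdV : Differentiable ℝ (fderiv ℝ V) := hV1.differentiable one_ne_zero
  -- the slices' gradients, as a function of `(y, σ)`
  have hslice : ∀ σ, fderiv ℝ (fun z => U z σ) y =
      (fderiv ℝ V (y, σ)).comp (ContinuousLinearMap.inl ℝ H ℝ) := fun σ =>
    (hasFDerivAt_slice_left (hVd (y, σ))).fderiv
  simp_rw [hslice]
  -- derivative in `σ` of `(fderiv V (y, σ)) ∘ inl`
  have h1 : HasDerivAt (fun σ : ℝ => fderiv ℝ V (y, σ))
      (fderiv ℝ (fderiv ℝ V) (y, τ) ((0 : H), (1 : ℝ))) τ := by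
    have h := (hdV (y, τ)).hasFDerivAt.comp τ (hasFDerivAt_prodMk_right y τ)
    have h' := h.hasDerivAt
    simp only [ContinuousLinearMap.comp_apply, ContinuousLinearMap.inr_apply] at h'
    exact h'
  have h2 : HasDerivAt (fun σ : ℝ => (fderiv ℝ V (y, σ)).comp (ContinuousLinearMap.inl ℝ H ℝ))
      ((fderiv ℝ (fderiv ℝ V) (y, τ) ((0 : H), (1 : ℝ))).comp (ContinuousLinearMap.inl ℝ H ℝ)) τ :=
    ((ContinuousLinearMap.compL ℝ H (H × ℝ) F).flip (ContinuousLinearMap.inl ℝ H ℝ)).hasFDerivAt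
      |>.comp_hasDerivAt τ h1
  -- derivative in `z` of `σ`-derivative `fderiv V (z, τ) (0, 1)`
  have h3 : HasFDerivAt (fun z : H => fderiv ℝ V (z, τ) ((0 : H), (1 : ℝ)))
      (((fderiv ℝ (fderiv ℝ V) (y, τ)).comp (ContinuousLinearMap.inl ℝ H ℝ)).flip
        ((0 : H), (1 : ℝ))) y := by
    have hc : HasFDerivAt ((fderiv ℝ V) ∘ fun z : H => (z, τ))
        ((fderiv ℝ (fderiv ℝ V) (y, τ)).comp (ContinuousLinearMap.inl ℝ H ℝ)) y :=
      HasFDerivAt.comp y (hdV (y, τ)).hasFDerivAt (hasFDerivAt_prodMk_left y τ)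
    have h := hc.clm_apply (hasFDerivAt_const ((0 : H), (1 : ℝ)) y)
    simp only [ContinuousLinearMap.comp_zero, zero_add] at h
    exact h
  rw [h3.fderiv]
  -- symmetry of the second derivative
  have hsymm : IsSymmSndFDerivAt ℝ V (y, τ) :=
    hU.contDiffAt.isSymmSndFDerivAt (by simp)
  refine h2.congr_deriv ?_
  ext h
  simp only [ContinuousLinearMap.comp_apply, ContinuousLinearMap.inl_apply,
    ContinuousLinearMap.flip_apply]
  exact hsymm _ _

end ParametricAverage

/-- **Lemma 7.2, (7.5), second bound** (pp. 24–25): if the profile is jointly `C²` and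
`|∇∂_sU(y,s)| ≤ C_{U,s}/(1+|y|²)` on `[0,S]` ((7.1), second bound), then the gradient of the
fluctuation `Ũ = U − ⟨U⟩_s` obeys `|∇Ũ(y,s)| ≤ C_{U,s} S/(1+|y|²)` for `s ∈ [0,S]`: indeed
`∇⟨U⟩_s = ⟨∇U⟩_s` (`hasFDerivAt_setAverage_Icc`), so `∇Ũ(·,s) = ∇U(·,s) − ⟨∇U⟩_s` is the time
fluctuation of `∇U`, whose time derivative is `∇∂_sU` (`hasDerivAt_fderiv_slice`), and the
first-bound argument (`norm_sub_setAverage_le`) applies. Operator norms throughout.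
[cite: PineauVicol2026, Lemma 7.2 (7.5) (pp. 24–25)] -/
theorem norm_fderiv_fluctuation_le
    {U : EuclideanSpace ℝ (Fin 3) → ℝ → EuclideanSpace ℝ (Fin 3)} {S C : ℝ} (hS : 0 < S)
    (hU : ContDiff ℝ 2 (fun p : EuclideanSpace ℝ (Fin 3) × ℝ => U p.1 p.2))
    (hder : ∀ y, ∀ τ ∈ Icc 0 S,
      ‖fderiv ℝ (fun z => fderiv ℝ (fun p : EuclideanSpace ℝ (Fin 3) × ℝ => U p.1 p.2) (z, τ)
        ((0 : EuclideanSpace ℝ (Fin 3)), (1 : ℝ))) y‖ ≤ C / (1 + ‖y‖ ^ 2))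
    (y : EuclideanSpace ℝ (Fin 3)) {s : ℝ} (hs : s ∈ Icc 0 S) :
    ‖fderiv ℝ (fun z => U z s - ⨍ τ in Icc 0 S, U z τ) y‖ ≤ C * S / (1 + ‖y‖ ^ 2) := by
  have hU1 : ContDiff ℝ 1 (fun p : EuclideanSpace ℝ (Fin 3) × ℝ => U p.1 p.2) :=
    hU.of_le (by norm_num)
  have hVd : Differentiable ℝ (fun p : EuclideanSpace ℝ (Fin 3) × ℝ => U p.1 p.2) :=
    hU.differentiable (by norm_num)
  -- `∇(U(·,s) − ⟨U⟩)(y) = ∇U(y,s) − ⟨∇U(y,·)⟩`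
  have hslice : HasFDerivAt (fun z => U z s) (fderiv ℝ (fun z => U z s) y) y :=
    (hasFDerivAt_slice_left (hVd (y, s))).differentiableAt.hasFDerivAt
  have havg := hasFDerivAt_setAverage_Icc (S := S) hU1 y
  have hsub : HasFDerivAt (fun z => U z s - ⨍ τ in Icc 0 S, U z τ)
      (fderiv ℝ (fun z => U z s) y - ⨍ τ in Icc 0 S, fderiv ℝ (fun z => U z τ) y) y :=
    hslice.sub havg
  rw [hsub.fderiv]
  -- time regularity of `τ ↦ ∇U(y, τ)`
  have hdiff : ∀ τ ∈ Icc 0 S, DifferentiableAt ℝ (fun σ => fderiv ℝ (fun z => U z σ) y) τ :=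
    fun τ _ => (hasDerivAt_fderiv_slice hU y τ).differentiableAt
  have hderiv : ∀ τ ∈ Icc 0 S, ‖deriv (fun σ => fderiv ℝ (fun z => U z σ) y) τ‖ ≤
      C / (1 + ‖y‖ ^ 2) := fun τ hτ => by
    rw [(hasDerivAt_fderiv_slice hU y τ).deriv]
    exact hder y τ hτ
  have hcont : ContinuousOn (fun σ => fderiv ℝ (fun z => U z σ) y) (Icc 0 S) := fun τ hτ =>
    (hdiff τ hτ).continuousAt.continuousWithinAt
  have hlip : ∀ τ ∈ Icc 0 S, ∀ τ' ∈ Icc 0 S,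
      ‖fderiv ℝ (fun z => U z τ) y - fderiv ℝ (fun z => U z τ') y‖ ≤
        C / (1 + ‖y‖ ^ 2) * |τ - τ'| := by
    intro τ hτ τ' hτ'
    have h := (convex_Icc 0 S).norm_image_sub_le_of_norm_deriv_le hdiff hderiv hτ' hτ
    simpa [Real.norm_eq_abs] using h
  have h := norm_sub_setAverage_le hS hcont hlip hs
  calc ‖fderiv ℝ (fun z => U z s) y - ⨍ τ in Icc 0 S, fderiv ℝ (fun z => U z τ) y‖
      ≤ C / (1 + ‖y‖ ^ 2) * S := h
    _ = C * S / (1 + ‖y‖ ^ 2) := by ring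

end PineauVicol2026

end Literature.Analysis.FluidPDE

end
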